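import Literature.NumberTheory.EllipticCurves.KugaSatoVarietySLCommute
import Literature.NumberTheory.EllipticCurves.KugaSatoSchollProjectorBetti
import HarnessLib

/-!
# `SL₂(ℤ/N)` acts on the `ε`-part of the Betti cohomology of a Kuga–Sato variety

Topic: `Literature/NumberTheory/EllipticCurves`. For a Kuga–Sato variety `V : KugaSatoVariety K m N`
over a subfield `K ⊆ ℂ`, `KugaSatoSchollProjectorBetti.lean` makes Scholl's projector `Π_ε`
(Deninger–Scholl 5.3 (i)) act on `Hⁱ_B(W) = Hⁱ(W(ℂ); ℚ)` with image the `ε`-part `schollPart V i`,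
and `KugaSatoVarietySLCommute.lean` shows that the automorphisms `slW g`, `g ∈ SL₂(ℤ/N)`, commute
with `Π_ε` in `ℚ[Aut W]`. Here we draw the consequence on cohomology:

* `map_slW_comp_schollProjectorBetti` — `(slW g)* ∘ Π_ε = Π_ε ∘ (slW g)*` on `Hⁱ_B(W)`;
* `map_slW_mem_schollPart` — **`SL₂(ℤ/N)` preserves the `ε`-part** `Π_ε Hⁱ_B(W)`;
* `schollPartSL V i` — the **`SL₂(ℤ/N)`-invariants of the `ε`-part**, the piece of `Hⁱ_B(W)`
  relevant to level-one forms (design notes of `KugaSatoVariety.lean`: "for level-one forms such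
  as `Δ` the relevant piece of `H^{m+1}(W)` is the `SL₂(ℤ/N)`-invariants of the `ε`-isotypic
  part"; taking invariants under `SL₂(ℤ/N) = Γ(1)/±Γ(N)` is the descent from level `N` to level
  one), with `mem_schollPartSL_iff` and `schollProjectorBetti_mem_schollPartSL` (`Π_ε` of an
  `SL₂(ℤ/N)`-invariant class is in it).

As in the companion files: `K : Type` (Betti cohomology), hypothesis `[IsCommMonObj V.curve.E]`,
no named facts, no Hodge theory, and no identification with spaces of cusp forms is asserted.

## References

* C. Deninger, A. J. Scholl, *The Beilinson conjectures*, in *L-functions and Arithmetic*,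
  LMS LNS 153 (1991), (4.10), 5.3 (i). [DeningerScholl1991]
* A. J. Scholl, *Motives for modular forms*, Invent. Math. 100 (1990), §1. [Scholl1990]
-/

open CategoryTheory Limits AlgebraicGeometry MonoidalCategory CartesianMonoidalCategory
open scoped MonObj MatrixGroups

noncomputable section

namespace Literature.NumberTheory.EllipticCurves

namespace KugaSatoVariety

open Literature.AlgebraicGeometry.Motives

variable {K : Type} [Field K] [Algebra K ℂ] {m N : ℕ} (V : KugaSatoVariety K m N)

/-- **`(slW g)* ∘ Π_ε = Π_ε ∘ (slW g)*` on `Hⁱ_B(W)`** (`[slW g]⁻¹` commutes with `Π_ε` in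
`ℚ[Aut W]`, `commute_schollProjector_of_slA_inv`). [cite: DeningerScholl1991, 5.3 (i)] -/
theorem map_slW_comp_schollProjectorBetti [NeZero N] [IsCommMonObj V.curve.E] (i : ℕ)
    (g : SL(2, ZMod N)) :
    (bettiCohomology.map (V.slW g).hom i).hom ∘ₗ V.schollProjectorBetti i =
      V.schollProjectorBetti i ∘ₗ (bettiCohomology.map (V.slW g).hom i).hom := by
  rw [show (V.slW g).hom = (V.slA g).hom from rfl, map_hom_eq_bettiAction, schollProjectorBetti,
    ← Module.End.mul_eq_comp, ← Module.End.mul_eq_comp, ← map_mul, ← map_mul,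
    (V.commute_schollProjector_of_slA_inv g).eq]

/-- Pointwise form: `(slW g)* (Π_ε x) = Π_ε ((slW g)* x)`. [cite: DeningerScholl1991, 5.3 (i)] -/
theorem map_slW_schollProjectorBetti [NeZero N] [IsCommMonObj V.curve.E] (i : ℕ)
    (g : SL(2, ZMod N)) (x : bettiCohomology V.W i) :
    bettiCohomology.map (V.slW g).hom i (V.schollProjectorBetti i x) =
      V.schollProjectorBetti i (bettiCohomology.map (V.slW g).hom i x) :=
  LinearMap.congr_fun (V.map_slW_comp_schollProjectorBetti i g) x

/-- **`SL₂(ℤ/N)` preserves the `ε`-part**: `x ∈ Π_ε Hⁱ_B(W) → (slW g)* x ∈ Π_ε Hⁱ_B(W)`.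
[cite: DeningerScholl1991, 5.3 (i)] -/
theorem map_slW_mem_schollPart [NeZero N] [IsCommMonObj V.curve.E] {i : ℕ}
    {x : bettiCohomology V.W i} (hx : x ∈ V.schollPart i) (g : SL(2, ZMod N)) :
    bettiCohomology.map (V.slW g).hom i x ∈ V.schollPart i := by
  obtain ⟨y, rfl⟩ := LinearMap.mem_range.mp hx
  exact LinearMap.mem_range.mpr ⟨_, (V.map_slW_schollProjectorBetti i g y).symm⟩

/-- **The `SL₂(ℤ/N)`-invariants of the `ε`-part** of `Hⁱ_B(W)`: the classes `x ∈ Π_ε Hⁱ_B(W)` with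
`(slW g)* x = x` for all `g ∈ SL₂(ℤ/N)` — the piece of the cohomology of `W` relevant to level-one
forms (invariants under `SL₂(ℤ/N) = Γ(1)/±Γ(N)` descend level `N` to level one; design notes of
`KugaSatoVariety.lean`). [folklore] -/
def schollPartSL [NeZero N] [IsCommMonObj V.curve.E] (i : ℕ) :
    Submodule ℚ (bettiCohomology V.W i) :=
  V.schollPart i ⊓
    ⨅ g : SL(2, ZMod N), LinearMap.eqLocus (bettiCohomology.map (V.slW g).hom i).hom LinearMap.id

/-- Membership in `schollPartSL`. [folklore] -/
theorem mem_schollPartSL_iff [NeZero N] [IsCommMonObj V.curve.E] (i : ℕ)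
    (x : bettiCohomology V.W i) :
    x ∈ V.schollPartSL i ↔
      x ∈ V.schollPart i ∧ ∀ g : SL(2, ZMod N), bettiCohomology.map (V.slW g).hom i x = x := by
  simp only [schollPartSL, Submodule.mem_inf, Submodule.mem_iInf, LinearMap.mem_eqLocus,
    LinearMap.id_apply]

/-- `schollPartSL ≤ schollPart`. [folklore] -/
theorem schollPartSL_le_schollPart [NeZero N] [IsCommMonObj V.curve.E] (i : ℕ) :
    V.schollPartSL i ≤ V.schollPart i :=
  inf_le_left

/-- **`Π_ε` of an `SL₂(ℤ/N)`-invariant class is an `SL₂(ℤ/N)`-invariant class of the `ε`-part**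
(because `(slW g)*` commutes with `Π_ε`). [folklore] -/
theorem schollProjectorBetti_mem_schollPartSL [NeZero N] [IsCommMonObj V.curve.E] (i : ℕ)
    {x : bettiCohomology V.W i}
    (hx : ∀ g : SL(2, ZMod N), bettiCohomology.map (V.slW g).hom i x = x) :
    V.schollProjectorBetti i x ∈ V.schollPartSL i := by
  rw [mem_schollPartSL_iff]
  exact ⟨V.schollProjectorBetti_mem_schollPart i x, fun g => by
    rw [map_slW_schollProjectorBetti, hx g]⟩

/-- `schollPartSL` is stable under `Π_ε` (indeed `Π_ε` is the identity on it). [folklore] -/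
theorem schollProjectorBetti_apply_of_mem_schollPartSL [NeZero N] [IsCommMonObj V.curve.E] (i : ℕ)
    {x : bettiCohomology V.W i} (hx : x ∈ V.schollPartSL i) : V.schollProjectorBetti i x = x :=
  (V.mem_schollPart_iff i x).mp ((V.mem_schollPartSL_iff i x).mp hx).1

end KugaSatoVariety

end Literature.NumberTheory.EllipticCurves

end
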